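import Summits.BirchSwinnertonDyer.Rank1Residual.AdditivePotMult.RankOneHeegnerOdd
import Summits.BirchSwinnertonDyer.Rank1Residual.Additive.GordManinConstant
import HarnessLib

/-!
# X4(M) at `p ≥ 11`, BOTH analytic ranks: `BSD(E,p)` ⇐ the LOWER halves of the same-`j` X4(M) pairs,
# with NO image hypothesis and NO Manin datum (cell `b2b-bsdres`, seat additive-p1, gen 11)

HONEST FRAMING (cell `b2b-bsdres`, run/shared/lean/b2b/bsd-rank1-residual/, verbatim in every
file): the goal of the cell is to DELETE the COMBINATION-SHAPED residual classes of the
Birch–Swinnerton-Dyer formula for ALL analytic-rank `≤ 1` elliptic curves over `ℚ` — "full BSD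
formula for every rank `≤ 1` curve in class `C`" assembled STRICTLY from published theorems — so
that the rank-`≤ 1` remainder becomes exactly the CONSTRUCTION-SHAPED classes, which are TYPED
(missing-input `Prop`s), NOT attempted. This is not "finishing BSD". The additive sub-cell (seats
additive-p1…p4) is a RESEARCH ROUTE on the construction-shaped classes X3/X4; sub-cell additive-p1
= the potentially MULTIPLICATIVE additive prime (X3♯(M) / X4(M)); no claim beyond the stated
classes; the labels of X3/X4 are UNCHANGED by this file; nothing is booked (referee).

Theorems only (pure compositions; no definition, no named fact minted).

The gen-10 capstone `bsdp_of_classX4M_of_surj_of_lowerHalves_of_odd` (p238418) states, at EVERY odd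
`p` and in BOTH analytic ranks: X4(M) ∧ surj(p), `r_an(E) ≤ 1`, a modular parametrisation datum with
`p ∤ c` (Manin), `p ∤ ∏_ℓ c_ℓ(E)` (used in rank 1 only) ⟹ `BSD(E,p)` ⇐ `MissingLowerBoundAt V p`
for the X4(M) pairs `V` with `j(V) = j(E)` — every other input published. Two of its binders are
DISCHARGED in print at `p ≥ 11`:
* surj(p): on X4(M) (`E[p]` irreducible, `E` potentially multiplicative at `p`) `ρ̄_{E,p}` is onto
  for every `p ≥ 11` — Balakrishnan–…–Bilu–Parent–Rebolledo 2019 Thm. 1.2 (no normaliser-of-split-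
  Cartan image for `p ≥ 11`, `hBC`) + the transvection supplied by the potentially multiplicative
  inertia + Serre (`GaloisImage/PotMultLargeImage.lean`, multr1-p2: `ClassX4M.surj_of_eleven_le`);
* Manin: for the STRONG curve (`hopt`: `Λ_E ⊆ c·Λ_f` at the conductor level) `p ∤ c` at every
  additive `p ≥ 11` off the (G)-ordinary cell, in particular at a potentially multiplicative `p`
  — Edixhoven 1991 Thm. 3 in the transcription A130 (`hEdx`) through additive-p2's
  `Additive.not_dvd_maninConstant_of_padicValRat_j_neg` (p240673).
So at `p ≥ 11` the X4(M) block reads, for the strong curve and hence (Cassels) for every curve of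
its isogeny class: **`BSD(E,p)` in analytic rank `≤ 1` ⇐ the LOWER halves of the same-`j` X4(M)
pairs, plus `p ∤ ∏_ℓ c_ℓ(E)` in rank 1** — the two typed items of RESIDUAL-MAP §E (X_E1 / the
rank-one lower half + Tamagawa defect) and nothing else. Census mass (S-b, N < 5·10⁵, §E): X4(M) at
`p ≥ 11`: 2 355 rank-0 + 6 rank-1 pairs; window N < 2·10⁴: rank 1 none (the rank-one (M) window
lives at `p ∈ {3, 5, 7}`, gens 10/11). X4(M) stays CONSTRUCTION-SHAPED; nothing booked.

**This file proves**
* `ClassX4M.missingUpperBoundAt_rankOne_of_eleven_le_of_strong_of_lowerTwists` — rank 1, `p ≥ 11`,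
  strong datum, `p ∤ ∏c`: the upper half from the LOWER halves of the rank-0 same-`j` twists;
* `bsdp_of_classX4M_of_eleven_le_of_strong_of_lowerHalves` — both ranks, `p ≥ 11`, strong datum;
* `bsdp_of_classX4M_of_isIsogenous_of_eleven_le_of_strong_of_lowerHalves` — every curve isogenous
  to such a strong curve (Cassels' isogeny invariance, `hCassels`, through `Wuthrich2014.bsdp_of_isIsogenous`).

References: Balakrishnan et al. 2019 [BalakrishnanEtAl2019] Thm. 1.2; Edixhoven 1991
[EdixhovenManin1991] Thm. 3; Gross–Zagier 1986 [GrossZagier1986]; McCallum 1991 [McCallumLMS1991]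
§1; Hoffstein–Luo 1997 [HoffsteinLuo1997]; Delbourgo 1998 [Delbourgo1998] Prop. 4; Kato 2004
[Kato2004Asterisque] Thm. 17.4; Cassels 1965 [Cassels1965ArithmeticVIII].
-/

noncomputable section

open scoped Classical NumberField

open WeierstrassCurve NumberField Literature.NumberTheory.EllipticCurves
  Literature.NumberTheory.EllipticCurves.ModularForms
  Literature.NumberTheory.EllipticCurves.Rank1Residual
  Literature.NumberTheory.EllipticCurves.Rank1Residual.Typed
  Literature.NumberTheory.EllipticCurves.BalakrishnanEtAl2019

namespace Summit.BirchSwinnertonDyer.Rank1Residual.AdditivePotMult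

open Additive GaloisImage

variable {W : WeierstrassCurve ℚ} [W.IsElliptic] [W.IsGloballyMinimal] {p : ℕ} [Fact p.Prime]

/-- **X4(M) ∧ `r_an(E) = 1` at `p ≥ 11`, strong datum, `p ∤ ∏_ℓ c_ℓ(E)`: the upper half
`ord_p #Ш(E) ≤ ord_p #Ш_an(E)` from the LOWER halves of the rank-`0` same-`j` X4(M) twists** — the
gen-10 theorem `ClassX4M.missingUpperBoundAt_rankOne_of_surj_of_lowerTwists_of_odd` (Gross–Zagier
`hGZ`, Kolyvagin `hKo`/`hB`, GZK, modularity, newform `hnf`, Hoffstein–Luo field `hHL`) with surj(p)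
from `p ≥ 11` (`hBC`, `ClassX4M.surj_of_eleven_le`) and the Manin datum from Edixhoven (`hEdx`,
strong datum `hopt`). No image and no Manin hypothesis left. Per the cell's rules nothing is booked.
[cite: BalakrishnanEtAl2019, §1 Thm. 1.2 (arXiv:1711.05846 p. 2)] [cite: EdixhovenManin1991, Thm. 3]
[cite: McCallumLMS1991, §1 Theorem (Kolyvagin), p. 296] [cite: GrossZagier1986, I (6.5) and V (2.1)] -/
theorem ClassX4M.missingUpperBoundAt_rankOne_of_eleven_le_of_strong_of_lowerTwists
    (hBC : thm12_not_le_normalizer_splitCartan)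
    (hEdx : edixhoven_not_dvd_maninConstant_of_not_potentiallyGoodOrdinary)
    (hGZ : ∀ (N : ℕ) [NeZero N] (W : WeierstrassCurve ℚ) (K : Type) [Field K] [NumberField K],
      gross_zagier N W K)
    (hKo : ∀ (N : ℕ) [NeZero N] (W : WeierstrassCurve ℚ) (K : Type) [Field K] [NumberField K],
      kolyvagin N W K)
    (hB : ∀ (N : ℕ) [NeZero N] (W : WeierstrassCurve ℚ) (K : Type) [Field K] [NumberField K],
      Kolyvagin1990_padicValNat_card_sha_le N W K)
    (hGZK : rank_eq_analyticRank_of_analyticRank_le_one) (hmod : hasEntireLFunction_rat)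
    (hnf : exists_isNewformOf) (hHL : HoffsteinLuo1997_exists_twist_L_one_ne_zero)
    [NeZero (W.conductorNorm ℤ)]
    (hX : ClassX4M W p) (hr : W.analyticRank = 1) (h11 : 11 ≤ p)
    (D : ModularParametrizationData W (W.conductorNorm ℤ))
    (hopt : ∀ z ∈ D.L.lattice, ∃ w ∈ periodLattice D.f, z = D.c * w)
    (htam : ¬ p ∣ W.tamagawaProduct)
    (hlow : ∀ (V : WeierstrassCurve ℚ) [V.IsElliptic] [V.IsGloballyMinimal], ClassX4M V p →
      V.j = W.j → V.analyticRank = 0 → MissingLowerBoundAt V p) :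
    MissingUpperBoundAt W p :=
  ClassX4M.missingUpperBoundAt_rankOne_of_surj_of_lowerTwists_of_odd hGZ hKo hB hGZK hmod hnf hHL hX
    hr (ClassX4M.surj_of_eleven_le hBC hX h11) D
    (Additive.not_dvd_maninConstant_of_padicValRat_j_neg W p hEdx D hopt (by omega)
      (ClassX4M.potMult W p hX).2) htam hlow

/-- **X4(M) at `p ≥ 11`, BOTH analytic ranks, strong datum: `BSD(E,p)` ⇐ the LOWER halves of the
same-`j` X4(M) pairs** (`p ∤ ∏_ℓ c_ℓ(E)` used in rank 1 only) — the gen-10 capstone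
`bsdp_of_classX4M_of_surj_of_lowerHalves_of_odd` with surj(p) from `p ≥ 11` (`hBC`) and the Manin
datum from Edixhoven (`hEdx`, `hopt`); every remaining input published (Delbourgo Prop. 4 `hDel`,
Wuthrich Lemma 20 `hL20` — idle at `p ≥ 11` —, Kato's `ω^{(p−1)/2}`-component `hKato`, Gross–Zagier,
Kolyvagin, GZK, modularity, Hoffstein–Luo). What is left of X4(M) at `p ≥ 11` is EXACTLY the typed
lower halves (+ the Tamagawa defect in rank 1). Nothing booked.
[cite: BalakrishnanEtAl2019, §1 Thm. 1.2 (arXiv:1711.05846 p. 2)] [cite: EdixhovenManin1991, Thm. 3]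
[cite: Delbourgo1998, Prop. 4 (p. 144)] [cite: Kato2004Asterisque, Thm. 17.4 (3) (p. 273)]
[cite: McCallumLMS1991, §1 Theorem (Kolyvagin), p. 296] -/
theorem bsdp_of_classX4M_of_eleven_le_of_strong_of_lowerHalves
    (hBC : thm12_not_le_normalizer_splitCartan)
    (hEdx : edixhoven_not_dvd_maninConstant_of_not_potentiallyGoodOrdinary)
    (hDel : Delbourgo1998.prop4_rankZero_pow_dvd_constantCoeff)
    (hmodD : nonempty_modularParametrizationData)
    (hL20 : Wuthrich2014.lemma20_surjective_threeAdic_of_semistable)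
    (hKato : Wuthrich2014.kato_halfEigenCharIdeal_dvd_cyclotomicPrime_of_surjective)
    (hGZ : ∀ (N : ℕ) [NeZero N] (W : WeierstrassCurve ℚ) (K : Type) [Field K] [NumberField K],
      gross_zagier N W K)
    (hKo : ∀ (N : ℕ) [NeZero N] (W : WeierstrassCurve ℚ) (K : Type) [Field K] [NumberField K],
      kolyvagin N W K)
    (hB : ∀ (N : ℕ) [NeZero N] (W : WeierstrassCurve ℚ) (K : Type) [Field K] [NumberField K],
      Kolyvagin1990_padicValNat_card_sha_le N W K)
    (hnf : exists_isNewformOf) (hHL : HoffsteinLuo1997_exists_twist_L_one_ne_zero)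
    (hGZK : rank_eq_analyticRank_of_analyticRank_le_one) (hmod : hasEntireLFunction_rat)
    [NeZero (W.conductorNorm ℤ)]
    (hX : ClassX4M W p) (hr : W.analyticRank ≤ 1) (h11 : 11 ≤ p)
    (D : ModularParametrizationData W (W.conductorNorm ℤ))
    (hopt : ∀ z ∈ D.L.lattice, ∃ w ∈ periodLattice D.f, z = D.c * w)
    (htam : ¬ p ∣ W.tamagawaProduct)
    (hlow : ∀ (V : WeierstrassCurve ℚ) [V.IsElliptic] [V.IsGloballyMinimal], ClassX4M V p →
      V.j = W.j → V.analyticRank ≤ 1 → MissingLowerBoundAt V p) :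
    BSDp W p :=
  bsdp_of_classX4M_of_surj_of_lowerHalves_of_odd hDel hmodD hL20 hKato hGZ hKo hB hnf hHL hGZK hmod hX
    hr (ClassX4M.surj_of_eleven_le hBC hX h11) D
    (Additive.not_dvd_maninConstant_of_padicValRat_j_neg W p hEdx D hopt (by omega)
      (ClassX4M.potMult W p hX).2) htam hlow

/-- **Every curve of the isogeny class**: for `W/ℚ` globally minimal, `ℚ`-isogenous to a strong X4(M)
curve `W₀` at `p ≥ 11` (`r_an(W₀) ≤ 1`, `p ∤ ∏_ℓ c_ℓ(W₀)`, strong datum `D₀`), the LOWER halves of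
the same-`j` X4(M) pairs give `BSDp W p` — Cassels' isogeny invariance of the BSD quotient
(`hCassels`, `Wuthrich2014.bsdp_of_isIsogenous`; `Ш(W₀)` finite by GZK, `L^{(r)}(W₀,1) ≠ 0` by
modularity). At class granularity (every isogeny class has a strong member) the X4(M) block at
`p ≥ 11` needs exactly the typed lower halves. Nothing booked. [cite: Cassels1965ArithmeticVIII]
[cite: BalakrishnanEtAl2019, §1 Thm. 1.2 (arXiv:1711.05846 p. 2)] [cite: EdixhovenManin1991, Thm. 3] -/
theorem bsdp_of_classX4M_of_isIsogenous_of_eleven_le_of_strong_of_lowerHalves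
    (hBC : thm12_not_le_normalizer_splitCartan)
    (hEdx : edixhoven_not_dvd_maninConstant_of_not_potentiallyGoodOrdinary)
    (hDel : Delbourgo1998.prop4_rankZero_pow_dvd_constantCoeff)
    (hmodD : nonempty_modularParametrizationData)
    (hL20 : Wuthrich2014.lemma20_surjective_threeAdic_of_semistable)
    (hKato : Wuthrich2014.kato_halfEigenCharIdeal_dvd_cyclotomicPrime_of_surjective)
    (hGZ : ∀ (N : ℕ) [NeZero N] (W : WeierstrassCurve ℚ) (K : Type) [Field K] [NumberField K],
      gross_zagier N W K)
    (hKo : ∀ (N : ℕ) [NeZero N] (W : WeierstrassCurve ℚ) (K : Type) [Field K] [NumberField K],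
      kolyvagin N W K)
    (hB : ∀ (N : ℕ) [NeZero N] (W : WeierstrassCurve ℚ) (K : Type) [Field K] [NumberField K],
      Kolyvagin1990_padicValNat_card_sha_le N W K)
    (hnf : exists_isNewformOf) (hHL : HoffsteinLuo1997_exists_twist_L_one_ne_zero)
    (hGZK : rank_eq_analyticRank_of_analyticRank_le_one) (hmod : hasEntireLFunction_rat)
    (hCassels : bsdRHS_eq_of_isIsogenous)
    {W W₀ : WeierstrassCurve ℚ} [W.IsElliptic] [W₀.IsElliptic] [W.IsGloballyMinimal]
    [W₀.IsGloballyMinimal] [NeZero (W₀.conductorNorm ℤ)] (hiso : IsIsogenous W W₀)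
    (hX : ClassX4M W₀ p) (hr : W₀.analyticRank ≤ 1) (h11 : 11 ≤ p)
    (D₀ : ModularParametrizationData W₀ (W₀.conductorNorm ℤ))
    (hopt : ∀ z ∈ D₀.L.lattice, ∃ w ∈ periodLattice D₀.f, z = D₀.c * w)
    (htam : ¬ p ∣ W₀.tamagawaProduct)
    (hlow : ∀ (V : WeierstrassCurve ℚ) [V.IsElliptic] [V.IsGloballyMinimal], ClassX4M V p →
      V.j = W₀.j → V.analyticRank ≤ 1 → MissingLowerBoundAt V p) :
    BSDp W p :=
  Wuthrich2014.bsdp_of_isIsogenous hCassels hiso (hGZK W₀ hr).2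
    (W₀.leadingLCoeff_ne_zero_holds (hmod W₀))
    (bsdp_of_classX4M_of_eleven_le_of_strong_of_lowerHalves hBC hEdx hDel hmodD hL20 hKato hGZ hKo hB
      hnf hHL hGZK hmod hX hr h11 D₀ hopt htam hlow)

end Summit.BirchSwinnertonDyer.Rank1Residual.AdditivePotMult

end
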